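import Literature.NumberTheory.LFunctions.MertensErrorTermsMeanValueRHWindow
import Literature.NumberTheory.LFunctions.MertensErrorTermsMeanValueRHPiLi
import Mathlib.MeasureTheory.Integral.IntervalIntegral.IntegrationByParts
import HarnessLib

/-!
# RH-EQUIVALENT literature, proof layer (RH-free calculus) — «nothing here bears on the truth of RH»
# Zhao 2025, toward Cor 1 for `i = 2`: integration by parts against the `θ`-tail `T(u) = ∫_u^∞ (θ(t) − t) t⁻² dt`

Proof companion of `MertensErrorTermsMeanValueRH.lean` (T. Zhao, Res. Number Theory 11 (2025) 62 =
arXiv:2411.18903 [bib: `Zhao2025MertensMean`]); theorems only, no definition, no named fact; everything here is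
RH-FREE real analysis. §2 of the source (sufficiency for `E₂`, "in the same vein as the earlier argument for `E₁`")
bounds `∫_X^∞ (π − li)/x²` through (2.6) `π − li = (θ − x)/log x + ∫₂ˣ (θ − u)/(u log² u) du + 2/log 2 − li(2)`
(the tree's `primeCounting_sub_logIntegral_eq`, Montgomery–Vaughan (13.5)) and termwise integration of the explicit
formula. The tree's route (this file and its sequel) replaces termwise integration by INTEGRATION BY PARTS against the
tail `T(u) = ∫_u^∞ (θ(t) − t) t⁻² dt`, whose two-sided size under RH is already in the tree
(`Zhao2025.mul_tail_le_of_RH'`, `Zhao2025.neg_mul_tail_le_of_RH`, from Rosser–Schoenfeld's Lemma 7 in exact form):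

* `Zhao2025.hasDerivWithinAt_tail` — `T` has RIGHT derivative `−(θ(x) − x)/x²` at every `x ≥ 2` (`θ` is constant on
  `[x, ⌊x⌋ + 1)`), and `Zhao2025.continuousOn_tail_Icc`;
* `Zhao2025.integral_thetaKernel_mul_eq_parts` — for `2 ≤ a ≤ b` and `φ ∈ C¹[a, b]`:
  `∫_a^b (θ − t) t⁻² φ(t) dt = T(a)φ(a) − T(b)φ(b) + ∫_a^b T(t) φ'(t) dt`
  (Mathlib's `intervalIntegral.integral_deriv_mul_eq_sub_of_hasDeriv_right`);
* `Zhao2025.integral_Ioi_thetaKernel_div_log_eq` — (★) `∫_y^∞ (θ − t)/(t² log t) dt = T(y)/log y − ∫_y^∞ T(t)/(t log² t) dt`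
  (`y ≥ 2`; the case `φ = 1/log`, `b → ∞`);
* `Zhao2025.integral_theta_sub_div_mul_log_sq_eq_parts` — `∫₂ˣ (θ − u)/(u log² u) du =
  T(2)·(2/log² 2) − T(x)·(x/log² x) + ∫₂ˣ T(u) (1/log² u − 2/log³ u) du` (the case `φ = u/log² u`);
* elementary majorants `∫_y^∞ t^{-3/2}/logᵏ t ≤ 2/(√y logᵏ y)` and `∫_a^x du/(√u log² u) ≤ 4√x/log² x` (`a ≥ e⁸`).
-/

noncomputable section

open Filter Topology Set MeasureTheory
open scoped Real Chebyshev

namespace Literature.NumberTheory.LFunctions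

namespace Zhao2025

/-! ### The tail `T(u) = ∫_u^∞ (θ − t)/t²`: continuity and right derivative -/

/-- `T(u) = T(2) − ∫₂ᵘ (θ − t)/t²` for `u ≥ 2`. [cite: Zhao2025MertensMean, §2 (after (2.1))] -/
theorem tail_eq_tail_two_sub {u : ℝ} (hu : 2 ≤ u) :
    ∫ t in Ioi u, (θ t - t) / t ^ 2 =
      (∫ t in Ioi (2 : ℝ), (θ t - t) / t ^ 2) - ∫ t in (2 : ℝ)..u, (θ t - t) / t ^ 2 := by
  rw [tail_eq_intervalIntegral_add le_rfl hu]; ring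

/-- The kernel `(θ − t)/t²` is interval integrable on `[a, b]`, `2 ≤ a ≤ b`. [cite: Zhao2025MertensMean, §2 (after (2.1))] -/
theorem intervalIntegrable_thetaKernel' {a b : ℝ} (ha : 2 ≤ a) (hab : a ≤ b) :
    IntervalIntegrable (fun t : ℝ => (θ t - t) / t ^ 2) volume a b := by
  rw [intervalIntegrable_iff_integrableOn_Ioc_of_le hab]
  exact integrableOn_thetaKernel_Ioc b ha

/-- `T` is continuous on every `[2, B]`. [cite: Zhao2025MertensMean, §2 (after (2.1))] -/
theorem continuousOn_tail_Icc (B : ℝ) :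
    ContinuousOn (fun u : ℝ => ∫ t in Ioi u, (θ t - t) / t ^ 2) (Icc 2 B) := by
  rcases lt_or_ge B 2 with hB | hB
  · rw [Icc_eq_empty (not_le.2 hB)]; exact continuousOn_empty _
  have hc : ContinuousOn (fun b => ∫ t in (2 : ℝ)..b, (θ t - t) / t ^ 2) (Icc 2 B) := by
    have h := intervalIntegral.continuousOn_primitive_interval (μ := volume) (a := (2 : ℝ)) (b := B)
      (f := fun t : ℝ => (θ t - t) / t ^ 2) (by rw [uIcc_of_le hB]; exact integrableOn_thetaKernel_Icc B)
    rwa [uIcc_of_le hB] at h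
  exact (continuousOn_const.sub hc).congr fun u hu => tail_eq_tail_two_sub hu.1

/-- `θ` is constant immediately to the right of every point: `θ =ᶠ[𝓝[>] x] θ(x)` (plumbing for the right derivative
of the tail). [cite: Zhao2025MertensMean, §2 (proof of Thm 1 for E₂)] -/
theorem theta_eventuallyEq_nhdsGT (x : ℝ) : (fun t : ℝ => θ t) =ᶠ[𝓝[>] x] fun _ => θ x := by
  rcases lt_or_ge x 0 with hx | hx
  · filter_upwards [Ioo_mem_nhdsGT hx] with t ht
    rw [Chebyshev.theta_eq_zero_of_lt_two (by linarith [ht.2]),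
      Chebyshev.theta_eq_zero_of_lt_two (by linarith)]
  · filter_upwards [Ioo_mem_nhdsGT (Nat.lt_floor_add_one x)] with t ht
    rw [Chebyshev.theta_eq_theta_coe_floor t, Chebyshev.theta_eq_theta_coe_floor x]
    congr 2
    rw [Nat.floor_eq_iff (hx.trans ht.1.le)]
    exact ⟨(Nat.floor_le hx).trans ht.1.le, ht.2⟩

/-- The kernel `(θ − t)/t²` is continuous from the right at every `x > 0` (plumbing).
[cite: Zhao2025MertensMean, §2 (proof of Thm 1 for E₂)] -/
theorem continuousWithinAt_thetaKernel_Ioi {x : ℝ} (hx : 0 < x) :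
    ContinuousWithinAt (fun t : ℝ => (θ t - t) / t ^ 2) (Ioi x) x := by
  have hc : ContinuousWithinAt (fun t : ℝ => (θ x - t) / t ^ 2) (Ioi x) x := by
    have hx2 : x ^ 2 ≠ 0 := by positivity
    have : ContinuousAt (fun t : ℝ => (θ x - t) / t ^ 2) x := by fun_prop (disch := assumption)
    exact this.continuousWithinAt
  refine hc.congr_of_eventuallyEq ?_ rfl
  filter_upwards [theta_eventuallyEq_nhdsGT x] with t ht
  rw [ht]

/-- **Right derivative of the tail**: for `x ≥ 2`, `u ↦ T(u) = ∫_u^∞ (θ − t)/t²` has right derivative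
`−(θ(x) − x)/x²` at `x` (the calculus behind the integration by parts replacing the source's termwise integration).
[cite: Zhao2025MertensMean, §2 (proof of Thm 1 for E₂)] -/
theorem hasDerivWithinAt_tail {x : ℝ} (hx : 2 ≤ x) :
    HasDerivWithinAt (fun u : ℝ => ∫ t in Ioi u, (θ t - t) / t ^ 2) (-((θ x - x) / x ^ 2)) (Ioi x) x := by
  have hprim : HasDerivWithinAt (fun u => ∫ t in (2 : ℝ)..u, (θ t - t) / t ^ 2) ((θ x - x) / x ^ 2) (Ici x) x :=
    intervalIntegral.integral_hasDerivWithinAt_right (intervalIntegrable_thetaKernel hx)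
      measurable_thetaKernel.stronglyMeasurable.stronglyMeasurableAtFilter
      (continuousWithinAt_thetaKernel_Ioi (by linarith))
  have h2 : HasDerivWithinAt
      (fun u => (∫ t in Ioi (2 : ℝ), (θ t - t) / t ^ 2) - ∫ t in (2 : ℝ)..u, (θ t - t) / t ^ 2)
      (-((θ x - x) / x ^ 2)) (Ioi x) x :=
    (hprim.mono Ioi_subset_Ici_self).const_sub _
  refine h2.congr_of_eventuallyEq ?_ (tail_eq_tail_two_sub hx)
  filter_upwards [self_mem_nhdsWithin] with u hu
  exact tail_eq_tail_two_sub (hx.trans (le_of_lt hu))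

/-! ### Integration by parts against the tail -/

/-- **Integration by parts against the tail**: for `2 ≤ a ≤ b`, `φ` continuous on `[a, b]` with derivative `φ'`
on `(a, b)`, `φ'` integrable:
`∫_a^b (θ(t) − t) t⁻² φ(t) dt = T(a) φ(a) − T(b) φ(b) + ∫_a^b T(t) φ'(t) dt`, `T(u) = ∫_u^∞ (θ − t)/t²`.
[cite: Zhao2025MertensMean, §2 (proof of Thm 1 for E₂, termwise integration replaced by integration by parts)] -/
theorem integral_thetaKernel_mul_eq_parts {a b : ℝ} (ha : 2 ≤ a) (hab : a ≤ b) {φ φ' : ℝ → ℝ}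
    (hφ : ContinuousOn φ (Icc a b)) (hφ' : ∀ t ∈ Ioo a b, HasDerivAt φ (φ' t) t)
    (hφ'i : IntervalIntegrable φ' volume a b) :
    ∫ t in a..b, (θ t - t) / t ^ 2 * φ t =
      (∫ t in Ioi a, (θ t - t) / t ^ 2) * φ a - (∫ t in Ioi b, (θ t - t) / t ^ 2) * φ b +
        ∫ t in a..b, (∫ u in Ioi t, (θ u - u) / u ^ 2) * φ' t := by
  set T : ℝ → ℝ := fun u => ∫ t in Ioi u, (θ t - t) / t ^ 2 with hT
  have hIcc : uIcc a b = Icc a b := uIcc_of_le hab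
  have hTc : ContinuousOn T (uIcc a b) := by
    rw [hIcc]; exact (continuousOn_tail_Icc b).mono (Icc_subset_Icc_left ha)
  have hφc : ContinuousOn φ (uIcc a b) := by rwa [hIcc]
  have hmin : min a b = a := min_eq_left hab
  have hmax : max a b = b := max_eq_right hab
  have hgi := intervalIntegrable_thetaKernel' ha hab
  have h := intervalIntegral.integral_deriv_mul_eq_sub_of_hasDeriv_right (u := T) (v := φ)
    (u' := fun t => -((θ t - t) / t ^ 2)) (v' := φ') (a := a) (b := b) hTc hφc
    (fun t ht => by rw [hmin, hmax] at ht; exact hasDerivWithinAt_tail (ha.trans ht.1.le))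
    (fun t ht => by rw [hmin, hmax] at ht; exact (hφ' t ht).hasDerivWithinAt)
    hgi.neg hφ'i
  have hi1 : IntervalIntegrable (fun t => -((θ t - t) / t ^ 2) * φ t) volume a b :=
    hgi.neg.mul_continuousOn hφc
  have hi2 : IntervalIntegrable (fun t => T t * φ' t) volume a b := hφ'i.continuousOn_mul hTc
  rw [intervalIntegral.integral_add hi1 hi2] at h
  have e : ∫ t in a..b, -((θ t - t) / t ^ 2) * φ t = -∫ t in a..b, (θ t - t) / t ^ 2 * φ t := by
    rw [← intervalIntegral.integral_neg]
    refine intervalIntegral.integral_congr fun t _ => ?_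
    ring
  rw [e] at h
  linarith

/-! ### The case `φ = 1/log`, `b → ∞`: the identity (★) -/

/-- `(θ − t)/(t² log t) = (θ − t) t⁻² · (log t)⁻¹` is integrable on `(y, ∞)`, `y ≥ 2`.
[cite: Zhao2025MertensMean, §2 (proof of Thm 1 for E₂)] -/
theorem integrableOn_thetaKernel_mul_inv_log {y : ℝ} (hy : 2 ≤ y) :
    IntegrableOn (fun t : ℝ => (θ t - t) / t ^ 2 * (Real.log t)⁻¹) (Ioi y) := by
  refine (integrableOn_thetaKernel_Ioi hy).mul_bdd (c := (Real.log 2)⁻¹)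
    ((Real.measurable_log.inv).aestronglyMeasurable) ?_
  rw [ae_restrict_iff' measurableSet_Ioi]
  refine Eventually.of_forall fun t ht => ?_
  have ht2 : 2 < t := lt_of_le_of_lt hy ht
  have hl2 : 0 < Real.log 2 := Real.log_pos one_lt_two
  have hlt : Real.log 2 ≤ Real.log t := Real.log_le_log two_pos ht2.le
  rw [Real.norm_eq_abs, abs_inv, abs_of_pos (hl2.trans_le hlt)]
  exact inv_anti₀ hl2 hlt

/-- `T(t) · t⁻¹/log² t` is integrable on `(y, ∞)`, `y ≥ 2` (`T` is bounded and measurable, `t⁻¹/log² t` integrable).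
[cite: Zhao2025MertensMean, §2 (proof of Thm 1 for E₂)] -/
theorem integrableOn_tail_mul_inv_div_log_sq {y : ℝ} (hy : 2 ≤ y) :
    IntegrableOn (fun t : ℝ => (∫ u in Ioi t, (θ u - u) / u ^ 2) * (t⁻¹ / Real.log t ^ 2)) (Ioi y) := by
  refine (Mertens.integrableOn_inv_div_log_sq.mono_set (Ioi_subset_Ioi hy)).bdd_mul
    (c := ∫ t in Ioi 1, |(θ t - t) / t ^ 2|) measurable_tail.aestronglyMeasurable ?_
  rw [ae_restrict_iff' measurableSet_Ioi]
  refine Eventually.of_forall fun t ht => ?_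
  rw [Real.norm_eq_abs]
  exact abs_tail_le (by linarith [lt_of_le_of_lt hy ht])

/-- **(★)**: for `y ≥ 2`, `∫_y^∞ (θ(t) − t)/(t² log t) dt = T(y)/log y − ∫_y^∞ T(t)/(t log² t) dt`
(integration by parts on `[y, Y]` with `φ = 1/log`, then `Y → ∞`: `T(Y)/log Y → 0` since `T` is bounded).
[cite: Zhao2025MertensMean, §2 (proof of Thm 1 for E₂)] -/
theorem integral_Ioi_thetaKernel_div_log_eq {y : ℝ} (hy : 2 ≤ y) :
    ∫ t in Ioi y, (θ t - t) / t ^ 2 * (Real.log t)⁻¹ =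
      (∫ t in Ioi y, (θ t - t) / t ^ 2) * (Real.log y)⁻¹ -
        ∫ t in Ioi y, (∫ u in Ioi t, (θ u - u) / u ^ 2) * (t⁻¹ / Real.log t ^ 2) := by
  set T : ℝ → ℝ := fun u => ∫ t in Ioi u, (θ t - t) / t ^ 2 with hT
  set A : ℝ := ∫ t in Ioi 1, |(θ t - t) / t ^ 2| with hA
  -- by parts on `[y, Y]`
  have hparts : ∀ Y : ℝ, y ≤ Y → ∫ t in y..Y, (θ t - t) / t ^ 2 * (Real.log t)⁻¹ =
      T y * (Real.log y)⁻¹ - T Y * (Real.log Y)⁻¹ - ∫ t in y..Y, T t * (t⁻¹ / Real.log t ^ 2) := by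
    intro Y hY
    have hφ : ContinuousOn (fun t : ℝ => (Real.log t)⁻¹) (Icc y Y) := by
      refine continuousOn_of_forall_continuousAt fun t ht => ?_
      have ht0 : t ≠ 0 := by linarith [ht.1]
      have hl : Real.log t ≠ 0 := (Real.log_pos (by linarith [ht.1])).ne'
      fun_prop (disch := assumption)
    have hφ' : ∀ t ∈ Ioo y Y, HasDerivAt (fun t : ℝ => (Real.log t)⁻¹) (-(t⁻¹ / Real.log t ^ 2)) t := by
      intro t ht
      have ht0 : t ≠ 0 := by linarith [ht.1]
      have hl : Real.log t ≠ 0 := (Real.log_pos (by linarith [ht.1])).ne'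
      have h := (Real.hasDerivAt_log ht0).inv hl
      refine h.congr_deriv ?_
      field_simp
    have hφ'i : IntervalIntegrable (fun t : ℝ => -(t⁻¹ / Real.log t ^ 2)) volume y Y := by
      rw [intervalIntegrable_iff_integrableOn_Ioc_of_le hY]
      exact (Mertens.integrableOn_inv_div_log_sq.mono_set (Ioc_subset_Ioi_self.trans (Ioi_subset_Ioi hy))).neg
    have h := integral_thetaKernel_mul_eq_parts hy hY hφ hφ' hφ'i
    rw [h]
    have e : ∫ t in y..Y, (∫ u in Ioi t, (θ u - u) / u ^ 2) * -(t⁻¹ / Real.log t ^ 2) =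
        -∫ t in y..Y, T t * (t⁻¹ / Real.log t ^ 2) := by
      rw [← intervalIntegral.integral_neg]
      refine intervalIntegral.integral_congr fun t _ => ?_
      simp only [hT]; ring
    rw [e]; ring
  -- the three limits as `Y → ∞`
  have hL : Tendsto (fun Y => ∫ t in y..Y, (θ t - t) / t ^ 2 * (Real.log t)⁻¹) atTop
      (𝓝 (∫ t in Ioi y, (θ t - t) / t ^ 2 * (Real.log t)⁻¹)) :=
    intervalIntegral_tendsto_integral_Ioi y (integrableOn_thetaKernel_mul_inv_log hy) tendsto_id
  have hR : Tendsto (fun Y => ∫ t in y..Y, T t * (t⁻¹ / Real.log t ^ 2)) atTop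
      (𝓝 (∫ t in Ioi y, T t * (t⁻¹ / Real.log t ^ 2))) :=
    intervalIntegral_tendsto_integral_Ioi y (integrableOn_tail_mul_inv_div_log_sq hy) tendsto_id
  have hB : Tendsto (fun Y => T Y * (Real.log Y)⁻¹) atTop (𝓝 0) := by
    have hmaj : Tendsto (fun Y : ℝ => A * (Real.log Y)⁻¹) atTop (𝓝 0) := by
      have h := (tendsto_inv_atTop_zero.comp Real.tendsto_log_atTop).const_mul A
      rw [mul_zero] at h
      exact h
    refine squeeze_zero_norm' ?_ hmaj
    filter_upwards [eventually_ge_atTop (2 : ℝ)] with Y hY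
    have hl : 0 < Real.log Y := Real.log_pos (by linarith)
    rw [norm_mul, Real.norm_eq_abs, Real.norm_eq_abs, abs_inv, abs_of_pos hl]
    exact mul_le_mul_of_nonneg_right (abs_tail_le (by linarith)) (inv_nonneg.2 hl.le)
  have hlim : Tendsto (fun Y => ∫ t in y..Y, (θ t - t) / t ^ 2 * (Real.log t)⁻¹) atTop
      (𝓝 (T y * (Real.log y)⁻¹ - 0 - ∫ t in Ioi y, T t * (t⁻¹ / Real.log t ^ 2))) := by
    refine ((tendsto_const_nhds.sub hB).sub hR).congr' ?_
    filter_upwards [eventually_ge_atTop y] with Y hY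
    rw [hparts Y hY]
  have := tendsto_nhds_unique hL hlim
  rw [this, sub_zero]

/-! ### The case `φ = u/log² u` on `[2, x]`: the integral `J(x) = ∫₂ˣ (θ − u)/(u log² u) du` -/

/-- **`J(x)` by parts**: for `x ≥ 2`,
`∫₂ˣ (θ(u) − u)/(u log² u) du = T(2)·(2/log² 2) − T(x)·(x/log² x) + ∫₂ˣ T(u)·(1/log² u − 2/log³ u) du`.
[cite: Zhao2025MertensMean, §2 (Lemma 6, asymptotic form of the tree)] -/
theorem integral_theta_sub_div_mul_log_sq_eq_parts {x : ℝ} (hx : 2 ≤ x) :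
    ∫ u in (2 : ℝ)..x, (θ u - u) / (u * Real.log u ^ 2) =
      (∫ t in Ioi (2 : ℝ), (θ t - t) / t ^ 2) * (2 / Real.log 2 ^ 2) -
        (∫ t in Ioi x, (θ t - t) / t ^ 2) * (x / Real.log x ^ 2) +
        ∫ u in (2 : ℝ)..x, (∫ t in Ioi u, (θ t - t) / t ^ 2) *
          ((Real.log u ^ 2)⁻¹ - 2 * (Real.log u ^ 3)⁻¹) := by
  have hφ : ContinuousOn (fun u : ℝ => u / Real.log u ^ 2) (Icc 2 x) := by
    refine continuousOn_of_forall_continuousAt fun u hu => ?_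
    have hu0 : u ≠ 0 := by linarith [hu.1]
    have hl : Real.log u ^ 2 ≠ 0 := pow_ne_zero _ (Real.log_pos (by linarith [hu.1])).ne'
    fun_prop (disch := assumption)
  have hφ' : ∀ u ∈ Ioo 2 x, HasDerivAt (fun u : ℝ => u / Real.log u ^ 2)
      ((Real.log u ^ 2)⁻¹ - 2 * (Real.log u ^ 3)⁻¹) u := by
    intro u hu
    have hu0 : u ≠ 0 := by linarith [hu.1]
    have hl : Real.log u ≠ 0 := (Real.log_pos (by linarith [hu.1])).ne'
    have hl2 : Real.log u ^ 2 ≠ 0 := pow_ne_zero _ hl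
    have hlog2 : HasDerivAt (fun y : ℝ => Real.log y ^ 2) (2 * Real.log u * u⁻¹) u := by
      have h := (Real.hasDerivAt_log hu0).mul (Real.hasDerivAt_log hu0)
      have e : (Real.log * Real.log : ℝ → ℝ) = fun y => Real.log y ^ 2 := by funext y; simp [pow_two]
      rw [e] at h
      exact h.congr_deriv (by ring)
    have h := (hasDerivAt_id u).div hlog2 hl2
    refine h.congr_deriv ?_
    simp only [id]
    field_simp
  have hφ'c : ContinuousOn (fun u : ℝ => (Real.log u ^ 2)⁻¹ - 2 * (Real.log u ^ 3)⁻¹) (uIcc 2 x) := by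
    rw [uIcc_of_le hx]
    refine continuousOn_of_forall_continuousAt fun u hu => ?_
    have hu0 : u ≠ 0 := by linarith [hu.1]
    have hl : Real.log u ≠ 0 := (Real.log_pos (by linarith [hu.1])).ne'
    have hl2 : Real.log u ^ 2 ≠ 0 := pow_ne_zero _ hl
    have hl3 : Real.log u ^ 3 ≠ 0 := pow_ne_zero _ hl
    fun_prop (disch := assumption)
  have h := integral_thetaKernel_mul_eq_parts le_rfl hx hφ hφ' hφ'c.intervalIntegrable
  have e : ∫ u in (2 : ℝ)..x, (θ u - u) / (u * Real.log u ^ 2) =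
      ∫ u in (2 : ℝ)..x, (θ u - u) / u ^ 2 * (u / Real.log u ^ 2) := by
    refine intervalIntegral.integral_congr fun u hu => ?_
    rw [uIcc_of_le hx] at hu
    have hu0 : u ≠ 0 := by linarith [hu.1]
    field_simp
  rw [e, h]

/-! ### Elementary majorants -/

/-- `∫_y^∞ t^{-3/2} (log t)^{-k} dt ≤ 2/(√y logᵏ y)` for `y > 1` (`1/logᵏ t ≤ 1/logᵏ y` on `[y, ∞)` and
`∫_y^∞ t^{-3/2} dt = 2/√y`); the source's `∫_X^∞ dx/(x^{3/2} log² x)` terms. [cite: Zhao2025MertensMean, §2 (proof of Thm 1 for E₂)] -/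
theorem integral_Ioi_rpow_neg_three_halves_div_log_pow_le {y : ℝ} (hy : 1 < y) (k : ℕ) :
    ∫ t in Ioi y, t ^ (-(3 / 2 : ℝ)) / Real.log t ^ k ≤ 2 / (Real.sqrt y * Real.log y ^ k) := by
  have hy0 : 0 < y := by linarith
  have hly : 0 < Real.log y := Real.log_pos hy
  have hval : ∫ t in Ioi y, t ^ (-(3 / 2 : ℝ)) / Real.log y ^ k = 2 / (Real.sqrt y * Real.log y ^ k) := by
    rw [integral_div, integral_Ioi_rpow_of_lt (by norm_num) hy0,
      show (-(3 / 2 : ℝ) + 1) = -(1 / 2) by norm_num, Real.sqrt_eq_rpow,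
      Real.rpow_neg hy0.le]
    field_simp
  rw [← hval]
  have hint : IntegrableOn (fun t : ℝ => t ^ (-(3 / 2 : ℝ)) / Real.log y ^ k) (Ioi y) :=
    (integrableOn_Ioi_rpow_of_lt (by norm_num : (-(3 / 2 : ℝ)) < -1) hy0).div_const _
  refine integral_mono_of_nonneg ?_ hint ?_
  · rw [EventuallyLE, ae_restrict_iff' measurableSet_Ioi]
    refine Eventually.of_forall fun t ht => ?_
    have ht1 : 1 < t := hy.trans ht
    exact div_nonneg (Real.rpow_nonneg (by linarith) _) (pow_nonneg (Real.log_pos ht1).le _)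
  · rw [EventuallyLE, ae_restrict_iff' measurableSet_Ioi]
    refine Eventually.of_forall fun t ht => ?_
    have ht1 : 1 < t := hy.trans ht
    have hlt : Real.log y ≤ Real.log t := Real.log_le_log hy0 (le_of_lt ht)
    exact div_le_div_of_nonneg_left (Real.rpow_nonneg (by linarith) _) (pow_pos hly _)
      (pow_le_pow_left₀ hly.le hlt k)

/-- `d/du (4√u/log² u) = (2 log u − 8)/(√u log³ u) ≥ 1/(√u log² u)` for `log u ≥ 8`; hence
`∫_a^x du/(√u log² u) ≤ 4√x/log² x` for `e⁸ ≤ a ≤ x` (the primitive `4√u/log² u` dominates); the source's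
`∫ du/(√u log³ u)`-type terms of Lemma 6. [cite: Zhao2025MertensMean, §2 (Lemma 6)] -/
theorem integral_inv_sqrt_mul_log_sq_le {a x : ℝ} (ha : Real.exp 8 ≤ a) (hax : a ≤ x) :
    ∫ u in a..x, (Real.sqrt u * Real.log u ^ 2)⁻¹ ≤ 4 * Real.sqrt x / Real.log x ^ 2 := by
  have he : (1 : ℝ) < Real.exp 8 := by
    have := Real.add_one_le_exp (8 : ℝ); linarith
  have ha1 : 1 < a := he.trans_le ha
  have ha0 : 0 < a := by linarith
  -- the primitive `F(u) = 4√u/log²u` and its derivative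
  have hderiv : ∀ u ∈ Icc a x, HasDerivAt (fun u : ℝ => 4 * Real.sqrt u / Real.log u ^ 2)
      ((2 * Real.log u - 8) / (Real.sqrt u * Real.log u ^ 3)) u := by
    intro u hu
    have hu0 : 0 < u := ha0.trans_le hu.1
    have hl : Real.log u ≠ 0 := (Real.log_pos (ha1.trans_le hu.1)).ne'
    have hl2 : Real.log u ^ 2 ≠ 0 := pow_ne_zero _ hl
    have hs : Real.sqrt u ≠ 0 := (Real.sqrt_pos.2 hu0).ne'
    have hss : Real.sqrt u * Real.sqrt u = u := Real.mul_self_sqrt hu0.le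
    have hlog2 : HasDerivAt (fun y : ℝ => Real.log y ^ 2) (2 * Real.log u / (Real.sqrt u * Real.sqrt u)) u := by
      have h := (Real.hasDerivAt_log hu0.ne').mul (Real.hasDerivAt_log hu0.ne')
      have e : (Real.log * Real.log : ℝ → ℝ) = fun y => Real.log y ^ 2 := by funext y; simp [pow_two]
      rw [e] at h
      exact h.congr_deriv (by rw [hss]; ring)
    have h := ((Real.hasDerivAt_sqrt hu0.ne').const_mul 4).div hlog2 hl2
    refine h.congr_deriv ?_
    field_simp
    ring
  have hmono : ∀ u ∈ Icc a x, (Real.sqrt u * Real.log u ^ 2)⁻¹ ≤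
      (2 * Real.log u - 8) / (Real.sqrt u * Real.log u ^ 3) := by
    intro u hu
    have hu0 : 0 < u := ha0.trans_le hu.1
    have hl8 : 8 ≤ Real.log u := by
      rw [← Real.log_exp 8]; exact Real.log_le_log (Real.exp_pos _) (ha.trans hu.1)
    have hl : 0 < Real.log u := by linarith
    have hs : 0 < Real.sqrt u := Real.sqrt_pos.2 hu0
    rw [inv_eq_one_div, div_le_div_iff₀ (by positivity) (by positivity)]
    have e : Real.sqrt u * Real.log u ^ 3 = (Real.sqrt u * Real.log u ^ 2) * Real.log u := by ring
    rw [e]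
    have hp : 0 < Real.sqrt u * Real.log u ^ 2 := by positivity
    nlinarith [mul_le_mul_of_nonneg_left hl8 hp.le]
  have hcont : ContinuousOn (fun u : ℝ => (2 * Real.log u - 8) / (Real.sqrt u * Real.log u ^ 3))
      (uIcc a x) := by
    rw [uIcc_of_le hax]
    refine continuousOn_of_forall_continuousAt fun u hu => ?_
    have hu0 : 0 < u := ha0.trans_le hu.1
    have hl : Real.log u ≠ 0 := (Real.log_pos (ha1.trans_le hu.1)).ne'
    have h3 : Real.sqrt u * Real.log u ^ 3 ≠ 0 := mul_ne_zero (Real.sqrt_pos.2 hu0).ne' (pow_ne_zero _ hl)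
    have hu0' : u ≠ 0 := hu0.ne'
    fun_prop (disch := assumption)
  have hcont0 : ContinuousOn (fun u : ℝ => (Real.sqrt u * Real.log u ^ 2)⁻¹) (uIcc a x) := by
    rw [uIcc_of_le hax]
    refine continuousOn_of_forall_continuousAt fun u hu => ?_
    have hu0 : 0 < u := ha0.trans_le hu.1
    have hl : Real.log u ≠ 0 := (Real.log_pos (ha1.trans_le hu.1)).ne'
    have h2 : Real.sqrt u * Real.log u ^ 2 ≠ 0 := mul_ne_zero (Real.sqrt_pos.2 hu0).ne' (pow_ne_zero _ hl)
    have hu0' : u ≠ 0 := hu0.ne'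
    fun_prop (disch := assumption)
  have hFTC : ∫ u in a..x, (2 * Real.log u - 8) / (Real.sqrt u * Real.log u ^ 3) =
      4 * Real.sqrt x / Real.log x ^ 2 - 4 * Real.sqrt a / Real.log a ^ 2 := by
    rw [intervalIntegral.integral_eq_sub_of_hasDerivAt (fun u hu => hderiv u (by rwa [uIcc_of_le hax] at hu))
      hcont.intervalIntegrable]
  calc ∫ u in a..x, (Real.sqrt u * Real.log u ^ 2)⁻¹
      ≤ ∫ u in a..x, (2 * Real.log u - 8) / (Real.sqrt u * Real.log u ^ 3) :=
        intervalIntegral.integral_mono_on hax hcont0.intervalIntegrable hcont.intervalIntegrable hmono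
    _ = 4 * Real.sqrt x / Real.log x ^ 2 - 4 * Real.sqrt a / Real.log a ^ 2 := hFTC
    _ ≤ 4 * Real.sqrt x / Real.log x ^ 2 := by
        have : 0 ≤ 4 * Real.sqrt a / Real.log a ^ 2 := by positivity
        linarith

end Zhao2025

end Literature.NumberTheory.LFunctions
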